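import Mathlib
import Literature.NumberTheory.LFunctions.HallTenenbaumTheorem01
import Literature.NumberTheory.LFunctions.MertensElementary
import Literature.NumberTheory.LFunctions.LogEulerProduct
import Literature.NumberTheory.LFunctions.RankinEisensteinFactorisation
import Literature.NumberTheory.LFunctions.TaoLogChowlaMoebius

/-!
# Zhang (2022) §7, (7.5): the mean square of `(κ ∗ a₁)(m)` — an Euler-product majorant of exponent `9`

Trunk T-ANT (NumberTheory/LFunctions). Y. Zhang, *Discrete mean estimates and the Landau–Siegel
zero*, arXiv:2211.02515v1 (2022) [Zhang2022LandauSiegel], §7 [p. 13 of the source], with (2.10)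
[p. 4] and (2.13) [p. 5]. **Status of the source: an unrefereed manuscript, a claimed result under
adjudication** (cell pub-zhang: audit + repair census of arXiv:2211.02515; no claim about
Landau–Siegel). Companion of `Zhang2022.ExponentLayerMV` (cell ALT seat 3, `HOME/ALT-3.md` §B3),
whose module docstring records as "ALT-3's ANALYTIC CLAIM, not proved here" the statement this file
PROVES.

The step of the source [p. 13]:

> Let `κ(n)` be given by `∑_n κ(n) n^{-s} = ζ(s+β₁)ζ(s+β₂)ζ(s+β₃)/ζ(s)`, and regard `a₁` as an
> arithmetic function. … By (7.4), the proof of (7.3) is reduced to showing that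
> `∑_{ψ∈Ψ₂} |∑_{m<P²} (κ∗a₁)(m)ψ(m)m^{-s}| |A(a₂;1−s,ψ̄)| = o(𝔓)`, `σ = 1/2`.  (7.5)
> Note that `(κ∗a₁)(m) = O(τ₅(m))`. The left side above is, by Cauchy's inequality,
> `≤ (∑_{ψ∈Ψ} |∑_{m<P²} (κ∗a₁)(m)ψ(m)m^{-s}|²)^{1/2} (∑_{ψ∈Ψ} |A(a₂;1−s,ψ̄)|⁴)^{1/4} (∑_{ψ∈Ψ₂} 1)^{1/4}`
> `≪ (P² ∑_{m<P²} τ₅(m)²/m)^{1/2} (P² ∑_{m<P²} τ₂(m)²/m)^{1/4} (∑_{ψ∈Ψ₂} 1)^{1/4}`.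
> This yields (7.5) by Proposition 2.1 and (2.9).

Here (7.2) `a₁(n) ≪ 1`, (2.13) `β₁ = iα(1 − 5c′α𝓛)`, `β₂ = 2iα(1 + c′α𝓛)`, `β₃ = 3iα(1 − c′α𝓛)`
are PURELY IMAGINARY, and (2.10) `α = π/log P`. The printed majorant `τ₅(m)²` makes the first factor
`(P² (log P²)^{25})^{1/2}` up to constants (`∑_{m≤x} τ₅(m)²/m ≍ (log x)^{25}`), which is the cell's
row X-7.05a / `ExponentLayer.AdmissibleA`, fourth conjunct (`E > 3·68 + (2·25+7)·9 = 717`).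

What this file PROVES (elementary; Hall–Tenenbaum (0.4) [HallTenenbaum1988] from the tree,
`HallTenenbaum.sum_div_le_prod_tsum`, and the tree's Chebyshev–Mertens bounds
`MertensBound.sum_inv_prime_le`, `MertensBound.sum_log_div_prime_le`,
`MertensBound.sum_inv_prime_mul_pred_le_one` [HardyWright2008, Thms 425, 427]):

* `sum_div_le` — for `f ≥ 0` multiplicative with `f(p) ≤ a + K log p` and `f(p^ν) ≤ (ν+1)^d`
  (`a d : ℕ`, `K ≥ 0`) and `X ≥ 2`:
  `∑_{n≤X} f(n)/n ≤ exp(4a + S_d) · exp(K log 4X) · (log X)^a`, `S_d = ∑_ν (ν+3)^d 2^{-ν}`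
  (`majorantConst a d = exp(4a + S_d)`). With `a = 25, K = 0, d = 8` it covers the printed `τ₅²` count
  (`τ₅(p)² = 25`, `τ₅(p^ν)² = binom(ν+4,4)² ≤ (ν+1)⁸`), exponent `25`;
* `sum_sq_div_le` — for `g ≥ 0` multiplicative with `g(p) ≤ 3 + B log p`, `g(p) ≤ 5`,
  `g(p^ν) ≤ (ν+1)^d`: `∑_{n≤X} g(n)²/n ≤ majorantConst 9 (2d) · exp(16B log 4X) · (log X)^9`
  (`g(p)² ≤ 9 + 16B log p`, `sq_le_nine_add`);
* `sum_norm_conv_sq_div_le` — for a multiplicative `κ : ArithmeticFunction ℂ` with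
  `‖κ(p)‖ ≤ 2 + B log p`, `‖κ(p)‖ ≤ 4`, `‖κ(p^i)‖ ≤ (i+1)^c`, and ANY `a` with `‖a(n)‖ ≤ C`:
  `∑_{m≤X} |(κ∗a)(m)|²/m ≤ C² · majorantConst 9 (2c+2) · exp(16B log 4X) · (log X)^9`, via the
  multiplicative majorant `|(κ∗a)(m)| ≤ C ∑_{d∣m} |κ(d)|` (`norm_conv_le`, `absDivSum`);
* `sum_norm_kappa_conv_sq_div_le` — THE INSTANCE OF (7.5): for Zhang's `κ = kappa b₁ b₂ b₃`
  (`β_j = i b_j`, `b_j ∈ ℝ`; `κ = n^{-β₁} ∗ n^{-β₂} ∗ n^{-β₃} ∗ μ`, `isMultiplicative_kappa`,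
  `kappa_apply_prime : κ(p) = p^{-β₁} + p^{-β₂} + p^{-β₃} − 1`, `norm_kappa_prime_le :
  ‖κ(p)‖ ≤ 2 + (|b₁|+|b₂|+|b₃|) log p`, `norm_kappa_prime_le_four`, `norm_kappa_prime_pow_le :
  ‖κ(p^k)‖ ≤ (k+1)³`) and any `‖a‖_∞ ≤ C`, `X ≥ 2`:
  `∑_{m≤X} |(κ∗a)(m)|²/m ≤ C² · majorantConst 9 8 · exp(16(|b₁|+|b₂|+|b₃|) log 4X) · (log X)^9`;
  and `sum_norm_kappa_conv_sq_div_le_of_mul_log_le`: if `(|b₁|+|b₂|+|b₃|) log X ≤ L` and `X ≥ 4`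
  the middle factor is `≤ exp(32L)`. In the source `X = P²`, `|b₁|+|b₂|+|b₃| ≤ 6α(1 + 5c′α𝓛)` by
  (2.13) and `α log P² = 2π` by (2.10), so `L = 12π(1 + 5c′α𝓛) = 12π(1 + o(1))`: the bound reads
  `‖a₁‖_∞² · O(1) · (log P²)^9`, i.e. exponent `k = 9` of `log P²` in place of `25` — the hypothesis
  `k5mv = 9` of the cell's variant system MV-E (rows X-ALT3.7.05a/b, T-ALT3.MV;
  `ExponentLayerMV.admissibleAK9_iff`, `lt_of_admissibleThresholdsK9`).

Numbers, not adjectives: the constant is ABSURD as a number and is not optimised —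
`majorantConst 9 8 = exp(36 + S₈)` with `S₈ = ∑_{ν≥0} (ν+3)⁸ 2^{-ν} = 8·(∑_{n≥0} n⁸2^{-n} − 64.5)
= 8 732 844` (`∑ n⁸/2ⁿ = 1 091 670`), and `e^{32L} ≈ e^{1206}` at `L = 12π`: the packaging
`1 + u ≤ eᵘ` is applied to every local factor including `p = 2, 3`, where the polynomial majorant
`(ν+1)⁸` of the prime-power values (against the true `binom(ν+4,4)²`-size) makes `u` of size `10⁶`.
None of this depends on `X`: only the EXPONENT of `log X` is asserted to drop (`25 → 9`), which
is all the exponent layer of the cell reads (powers of `𝓛 = log D`; `log P² = 2𝓛⁹`, and the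
source takes `D` beyond an effectively computable bound). The mechanism is the one named in
ALT-3.md §B3: `g(p) = 1 + |κ(p)|` and `|κ(p)| ≤ 2 + (∑|b_j|) log p` (three unimodular shifts minus
Möbius' `−1`), so `g(p)² ≤ 9 + 16(∑|b_j|) log p`, and `∑_{p≤X} (log p)/p ≤ log 4X` turns the
`log p`-part into the `X`-independent factor `exp(16 (∑|b_j|) log 4X) ≤ e^{32L}`.

Scope (deliberately NOT here): the large sieve / Hölder step of (7.5) itself (`Section3MeanValues`),
Proposition 2.1, the identity `∑ κ(n)n^{-s} = ζ(s+β₁)ζ(s+β₂)ζ(s+β₃)/ζ(s)` as an `LSeries` statement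
(`kappa` is DEFINED as the Dirichlet convolution of the four coefficient sequences, which is that
identity at the level of coefficients), and the two Prop. 14.1 call sites (15.5), (16.1), whose
weights `b` are manuscript-specific (ALT-3.md §B3 records the same count there; `sum_sq_div_le`
is stated abstractly so as to cover any majorant of that shape). Nothing here bears on the cell's
verdict on (8.24)/(2.32) (`Section8Certificate.not_ineq824`); no statement about Theorems 1–2 of
the source is made or implied.
-/

noncomputable section

open Finset Real ArithmeticFunction

namespace Literature.NumberTheory.LFunctions.Zhang2022.MeanSquareMajorant

/-! ### The constants -/

/-- The constant of the majorant: `majorantConst a d = exp(4a + S_d)`, where `4` is the constant of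
the tree's Mertens bound `∑_{p≤X} 1/p ≤ log log X + 4` and `S_d = ∑_{ν≥0} (ν+3)^d 2^{-ν}` is the
tree's `LogEulerProduct.tailConst d` (the same tail majorant, there for `log` of an Euler product).
[folklore] -/
def majorantConst (a d : ℕ) : ℝ := Real.exp (4 * a + LogEulerProduct.tailConst d)

/-- `0 < majorantConst a d`. [folklore] -/
theorem majorantConst_pos (a d : ℕ) : 0 < majorantConst a d := Real.exp_pos _

/-! ### Part 1. The Euler-product majorant (Hall–Tenenbaum (0.4) + Mertens) -/

variable {f : ℕ → ℝ}

/-- The prime sum: if `f(p) ≤ a + K log p` (`K ≥ 0`) then for `X ≥ 2`,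
`∑_{p≤X} f(p)/p ≤ a (log log X + 4) + K (log X + log 4)` (Mertens' two theorems in the tree's
Chebyshev form). [folklore] -/
theorem sum_prime_div_le {a : ℕ} {K : ℝ} (hK : 0 ≤ K)
    (hfp : ∀ p, p.Prime → f p ≤ a + K * Real.log p) {X : ℕ} (hX : 2 ≤ X) :
    ∑ p ∈ Nat.primesLE X, f p / p ≤
      a * (Real.log (Real.log X) + 4) + K * (Real.log X + Real.log 4) := by
  have h1 : ∀ p ∈ Nat.primesLE X, f p / p ≤ a * (1 / p) + K * (Real.log p / p) := by
    intro p hp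
    have hp' := (Nat.mem_primesLE.1 hp).2
    have hp0 : (0 : ℝ) < p := by exact_mod_cast hp'.pos
    rw [div_le_iff₀ hp0]
    calc f p ≤ a + K * Real.log p := hfp p hp'
      _ = (a * (1 / p) + K * (Real.log p / p)) * p := by field_simp
  calc ∑ p ∈ Nat.primesLE X, f p / p
      ≤ ∑ p ∈ Nat.primesLE X, (a * (1 / p) + K * (Real.log p / p)) := sum_le_sum h1
    _ = a * ∑ p ∈ Nat.primesLE X, (1 : ℝ) / p + K * ∑ p ∈ Nat.primesLE X, Real.log p / p := by
        rw [sum_add_distrib, mul_sum, mul_sum]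
    _ ≤ a * (Real.log (Real.log X) + 4) + K * (Real.log X + Real.log 4) := by
        gcongr
        · exact MertensBound.sum_inv_prime_le X hX
        · exact MertensBound.sum_log_div_prime_le X

/-- `t² ≤ 9 + 16u` whenever `0 ≤ t ≤ 5`, `t ≤ 3 + u`, `u ≥ 0` (`u ≥ 1`: `t² ≤ 25`; `u < 1`:
`t² ≤ (3+u)² ≤ 9 + 7u`). [folklore] -/
theorem sq_le_nine_add {t u : ℝ} (ht0 : 0 ≤ t) (ht5 : t ≤ 5) (htu : t ≤ 3 + u) (hu : 0 ≤ u) :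
    t ^ 2 ≤ 9 + 16 * u := by
  rcases le_or_gt 1 u with h | h
  · nlinarith
  · nlinarith [mul_nonneg ht0 (sub_nonneg.2 htu), mul_nonneg hu (sub_nonneg.2 htu),
      mul_nonneg hu (sub_nonneg.2 h.le)]

/-- **The Euler-product majorant.** Let `f ≥ 0` be multiplicative (`f 1 = 1`,
`f(mn) = f(m)f(n)` for coprime `m, n`) with `f(p) ≤ a + K log p` (`a : ℕ`, `K ≥ 0`) and
`f(p^ν) ≤ (ν+1)^d` at prime powers. Then for `X ≥ 2`,
`∑_{n≤X} f(n)/n ≤ majorantConst a d · exp(K · log 4X) · (log X)^a`.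
Proof: Hall–Tenenbaum (0.4) `∑_{n≤X} f(n)/n ≤ ∏_{p≤X} ∑_ν f(p^ν)/p^ν`; each local factor is
`1 + f(p)/p + T_p ≤ exp(f(p)/p + T_p)` with `T_p ≤ S_d/p²`; `∑_{p≤X} 1/p² ≤ ∑ 1/(p(p−1)) ≤ 1`;
`∑_{p≤X} f(p)/p ≤ a(log log X + 4) + K log 4X` (`sum_prime_div_le`); `exp(a log log X) = (log X)^a`.
[cite: HallTenenbaum1988, (0.4) (§0.2, book p. 2)] -/
theorem sum_div_le (hf1 : f 1 = 1) (hmul : ∀ m n, Nat.Coprime m n → f (m * n) = f m * f n)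
    (hf0 : ∀ n, 0 ≤ f n) {a d : ℕ} {K : ℝ} (hK : 0 ≤ K)
    (hfp : ∀ p, p.Prime → f p ≤ a + K * Real.log p)
    (hfpow : ∀ p ν : ℕ, p.Prime → f (p ^ ν) ≤ ((ν : ℝ) + 1) ^ d) {X : ℕ} (hX : 2 ≤ X) :
    ∑ n ∈ Icc 1 X, f n / n ≤
      majorantConst a d * Real.exp (K * Real.log (4 * X)) * Real.log X ^ a := by
  -- termwise bound of the local series: `f(p^ν)/p^ν ≤ (ν+1)^d 2^{-ν}`
  have hterm : ∀ p ν : ℕ, p.Prime → f (p ^ ν) / (p : ℝ) ^ ν ≤ ((ν : ℝ) + 1) ^ d * (1 / 2 : ℝ) ^ ν := by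
    intro p ν hp
    have hp2 : (2 : ℝ) ≤ p := by exact_mod_cast hp.two_le
    have hppos : (0 : ℝ) < (p : ℝ) ^ ν := by positivity
    rw [div_le_iff₀ hppos]
    have h1 : (1 : ℝ) ≤ (1 / 2 : ℝ) ^ ν * (p : ℝ) ^ ν := by
      rw [← mul_pow]; exact one_le_pow₀ (by linarith)
    calc f (p ^ ν) ≤ ((ν : ℝ) + 1) ^ d := hfpow p ν hp
      _ ≤ ((ν : ℝ) + 1) ^ d * ((1 / 2 : ℝ) ^ ν * (p : ℝ) ^ ν) :=
          le_mul_of_one_le_right (by positivity) h1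
      _ = ((ν : ℝ) + 1) ^ d * (1 / 2 : ℝ) ^ ν * (p : ℝ) ^ ν := by ring
  -- hence each local series converges
  have hsum : ∀ p, p.Prime → Summable (fun ν : ℕ => f (p ^ ν) / (p : ℝ) ^ ν) := by
    intro p hp
    refine Summable.of_nonneg_of_le (fun ν => div_nonneg (hf0 _) (by positivity))
      (fun ν => (hterm p ν hp).trans ?_) (LogEulerProduct.summable_tailConst d)
    exact mul_le_mul_of_nonneg_right
      (pow_le_pow_left₀ (by positivity) (by linarith) d) (by positivity)
  -- the tail `ν ≥ 2`: termwise `f(p^{i+2})/p^{i+2} ≤ (i+3)^d 2^{-i} / p²`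
  have hterm2 : ∀ p i : ℕ, p.Prime →
      f (p ^ (i + 2)) / (p : ℝ) ^ (i + 2) ≤ ((i : ℝ) + 3) ^ d * (1 / 2 : ℝ) ^ i / (p : ℝ) ^ 2 := by
    intro p i hp
    have hp2 : (2 : ℝ) ≤ p := by exact_mod_cast hp.two_le
    rw [div_le_div_iff₀ (by positivity) (by positivity)]
    have h1 : f (p ^ (i + 2)) ≤ ((i : ℝ) + 3) ^ d := by
      have h := hfpow p (i + 2) hp
      have e : ((↑(i + 2) : ℝ) + 1) = (i : ℝ) + 3 := by push_cast; ring
      rwa [e] at h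
    have h2 : (p : ℝ) ^ 2 ≤ (1 / 2 : ℝ) ^ i * (p : ℝ) ^ (i + 2) := by
      rw [pow_add, ← mul_assoc, ← mul_pow]
      exact le_mul_of_one_le_left (by positivity) (one_le_pow₀ (by linarith))
    calc f (p ^ (i + 2)) * (p : ℝ) ^ 2 ≤ ((i : ℝ) + 3) ^ d * (p : ℝ) ^ 2 :=
          mul_le_mul_of_nonneg_right h1 (by positivity)
      _ ≤ ((i : ℝ) + 3) ^ d * ((1 / 2 : ℝ) ^ i * (p : ℝ) ^ (i + 2)) :=
          mul_le_mul_of_nonneg_left h2 (by positivity)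
      _ = ((i : ℝ) + 3) ^ d * (1 / 2 : ℝ) ^ i * (p : ℝ) ^ (i + 2) := by ring
  have htail : ∀ p, p.Prime →
      ∑' i : ℕ, f (p ^ (i + 2)) / (p : ℝ) ^ (i + 2) ≤ LogEulerProduct.tailConst d / (p : ℝ) ^ 2 := by
    intro p hp
    have hs1 := (summable_nat_add_iff (f := fun ν : ℕ => f (p ^ ν) / (p : ℝ) ^ ν) 2).mpr
      (hsum p hp)
    have hs2 : Summable (fun i : ℕ => ((i : ℝ) + 3) ^ d * (1 / 2 : ℝ) ^ i / (p : ℝ) ^ 2) :=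
      (LogEulerProduct.summable_tailConst d).div_const _
    calc ∑' i : ℕ, f (p ^ (i + 2)) / (p : ℝ) ^ (i + 2)
        ≤ ∑' i : ℕ, ((i : ℝ) + 3) ^ d * (1 / 2 : ℝ) ^ i / (p : ℝ) ^ 2 :=
          Summable.tsum_le_tsum (fun i => hterm2 p i hp) hs1 hs2
      _ = LogEulerProduct.tailConst d / (p : ℝ) ^ 2 := by rw [tsum_div_const]; rfl
  -- each local factor: `∑_ν f(p^ν)/p^ν = 1 + f(p)/p + T_p ≤ exp(f(p)/p + S_d/p²)`
  have hloc : ∀ p, p.Prime →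
      ∑' ν : ℕ, f (p ^ ν) / (p : ℝ) ^ ν ≤ Real.exp (f p / p + LogEulerProduct.tailConst d / (p : ℝ) ^ 2) := by
    intro p hp
    have hsplit := (hsum p hp).sum_add_tsum_nat_add 2
    have h2 : ∑ i ∈ range 2, f (p ^ i) / (p : ℝ) ^ i = 1 + f p / p := by
      simp [Finset.sum_range_succ, hf1]
    rw [← hsplit, h2]
    have ht := htail p hp
    calc 1 + f p / p + ∑' i : ℕ, f (p ^ (i + 2)) / (p : ℝ) ^ (i + 2)
        ≤ (f p / p + LogEulerProduct.tailConst d / (p : ℝ) ^ 2) + 1 := by linarith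
      _ ≤ _ := Real.add_one_le_exp _
  have hprod : ∏ p ∈ Nat.primesLE X, ∑' ν : ℕ, f (p ^ ν) / (p : ℝ) ^ ν ≤
      Real.exp (∑ p ∈ Nat.primesLE X, (f p / p + LogEulerProduct.tailConst d / (p : ℝ) ^ 2)) := by
    rw [Real.exp_sum]
    exact prod_le_prod (fun p _ => tsum_nonneg fun ν => div_nonneg (hf0 _) (by positivity))
      fun p hp => hloc p (Nat.mem_primesLE.1 hp).2
  -- `∑_{p≤X} S_d/p² ≤ S_d`
  have htailsum :
      ∑ p ∈ Nat.primesLE X, LogEulerProduct.tailConst d / (p : ℝ) ^ 2 ≤ LogEulerProduct.tailConst d := by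
    have hS := LogEulerProduct.tailConst_nonneg d
    calc ∑ p ∈ Nat.primesLE X, LogEulerProduct.tailConst d / (p : ℝ) ^ 2
        = LogEulerProduct.tailConst d * ∑ p ∈ Nat.primesLE X, 1 / (p : ℝ) ^ 2 := by
          rw [mul_sum]; exact sum_congr rfl fun p _ => by ring
      _ ≤ LogEulerProduct.tailConst d * ∑ p ∈ Nat.primesLE X, (1 : ℝ) / (p * (p - 1)) := by
          refine mul_le_mul_of_nonneg_left (sum_le_sum fun p hp => ?_) hS
          have hp2 : (2 : ℝ) ≤ p := by exact_mod_cast (Nat.mem_primesLE.1 hp).2.two_le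
          exact one_div_le_one_div_of_le (by nlinarith) (by nlinarith)
      _ ≤ LogEulerProduct.tailConst d * 1 :=
          mul_le_mul_of_nonneg_left (MertensBound.sum_inv_prime_mul_pred_le_one X) hS
      _ = LogEulerProduct.tailConst d := mul_one _
  have hexp : ∑ p ∈ Nat.primesLE X, (f p / p + LogEulerProduct.tailConst d / (p : ℝ) ^ 2) ≤
      a * (Real.log (Real.log X) + 4) + K * (Real.log X + Real.log 4) +
        LogEulerProduct.tailConst d := by
    rw [sum_add_distrib]
    linarith [sum_prime_div_le hK hfp hX]
  -- assemble
  have hX1 : (1 : ℝ) < X := by exact_mod_cast hX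
  have hX0 : (0 : ℝ) < X := by linarith
  have hlogX : 0 < Real.log X := Real.log_pos hX1
  calc ∑ n ∈ Icc 1 X, f n / n
      ≤ ∏ p ∈ Nat.primesLE X, ∑' ν : ℕ, f (p ^ ν) / (p : ℝ) ^ ν :=
        HallTenenbaum.sum_div_le_prod_tsum hf1 hmul hf0 hsum X
    _ ≤ Real.exp (∑ p ∈ Nat.primesLE X, (f p / p + LogEulerProduct.tailConst d / (p : ℝ) ^ 2)) := hprod
    _ ≤ Real.exp (a * (Real.log (Real.log X) + 4) + K * (Real.log X + Real.log 4) +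
          LogEulerProduct.tailConst d) := Real.exp_le_exp.2 hexp
    _ = majorantConst a d * Real.exp (K * Real.log (4 * X)) * Real.log X ^ a := by
        rw [majorantConst]
        have e1 : Real.log (4 * X) = Real.log X + Real.log 4 := by
          rw [Real.log_mul (by norm_num) hX0.ne', add_comm]
        have e2 : Real.log X ^ a = Real.exp (a * Real.log (Real.log X)) := by
          rw [← Real.log_pow, Real.exp_log (pow_pos hlogX a)]
        rw [e1, e2, ← Real.exp_add, ← Real.exp_add]
        congr 1; ring

/-- **The squared form.** Let `g ≥ 0` be multiplicative with `g(p) ≤ 3 + B log p`, `g(p) ≤ 5`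
(`B ≥ 0`) and `g(p^ν) ≤ (ν+1)^d`. Then for `X ≥ 2`,
`∑_{n≤X} g(n)²/n ≤ majorantConst 9 (2d) · exp(16B · log 4X) · (log X)^9`
(`sum_div_le` for `f = g²`, `f(p) ≤ 9 + 16B log p` by `sq_le_nine_add`). [folklore] -/
theorem sum_sq_div_le {g : ℕ → ℝ} (hg1 : g 1 = 1)
    (hmul : ∀ m n, Nat.Coprime m n → g (m * n) = g m * g n) (hg0 : ∀ n, 0 ≤ g n)
    {B : ℝ} (hB : 0 ≤ B) {d : ℕ}
    (hgp : ∀ p, p.Prime → g p ≤ 3 + B * Real.log p) (hgp5 : ∀ p, p.Prime → g p ≤ 5)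
    (hgpow : ∀ p ν : ℕ, p.Prime → g (p ^ ν) ≤ ((ν : ℝ) + 1) ^ d) {X : ℕ} (hX : 2 ≤ X) :
    ∑ n ∈ Icc 1 X, g n ^ 2 / n ≤
      majorantConst 9 (2 * d) * Real.exp (16 * B * Real.log (4 * X)) * Real.log X ^ 9 := by
  have h := sum_div_le (f := fun n => g n ^ 2) (a := 9) (d := 2 * d) (K := 16 * B)
    (by simp [hg1]) (fun m n hmn => by simp only [hmul m n hmn]; ring) (fun n => sq_nonneg _)
    (by positivity) ?_ ?_ hX
  · exact h
  · intro p hp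
    have hlogp : 0 ≤ Real.log p := Real.log_nonneg (by exact_mod_cast hp.one_lt.le)
    have := sq_le_nine_add (hg0 p) (hgp5 p hp) (hgp p hp) (mul_nonneg hB hlogp)
    push_cast
    linarith
  · intro p ν hp
    calc g (p ^ ν) ^ 2 ≤ (((ν : ℝ) + 1) ^ d) ^ 2 := pow_le_pow_left₀ (hg0 _) (hgpow p ν hp) 2
      _ = ((ν : ℝ) + 1) ^ (2 * d) := by rw [← pow_mul, mul_comm]

/-! ### Part 2. Dirichlet convolutions with a bounded sequence -/

/-- `(κ ∗ a)(m) = ∑_{m = k n} κ(k) a(n)` — the Dirichlet convolution of an arithmetic function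
with a sequence `a` (for `m ≥ 1` only `a(n)`, `n ≥ 1`, enter). [folklore] -/
def conv (κ : ArithmeticFunction ℂ) (a : ℕ → ℂ) (m : ℕ) : ℂ :=
  ∑ x ∈ m.divisorsAntidiagonal, κ x.1 * a x.2

/-- `n ↦ ‖κ n‖` as a real arithmetic function. [folklore] -/
def normAF (κ : ArithmeticFunction ℂ) : ArithmeticFunction ℝ :=
  ⟨fun n => ‖κ n‖, by simp⟩

/-- Unfolding `normAF`. [folklore] -/
theorem normAF_apply (κ : ArithmeticFunction ℂ) (n : ℕ) : normAF κ n = ‖κ n‖ := rfl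

/-- `normAF κ` is multiplicative when `κ` is. [folklore] -/
theorem isMultiplicative_normAF {κ : ArithmeticFunction ℂ} (hκ : κ.IsMultiplicative) :
    (normAF κ).IsMultiplicative :=
  ⟨by simp [normAF_apply, hκ.map_one], fun hmn => by
    simp [normAF_apply, hκ.map_mul_of_coprime hmn]⟩

/-- The multiplicative majorant `m ↦ ∑_{d ∣ m} ‖κ d‖ = (|κ| ∗ 𝟙)(m)`. [folklore] -/
def absDivSum (κ : ArithmeticFunction ℂ) : ArithmeticFunction ℝ :=
  normAF κ * (ArithmeticFunction.zeta : ArithmeticFunction ℝ)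

/-- `absDivSum κ m = ∑_{d ∣ m} ‖κ d‖`. [folklore] -/
theorem absDivSum_apply (κ : ArithmeticFunction ℂ) (m : ℕ) :
    absDivSum κ m = ∑ d ∈ m.divisors, ‖κ d‖ := by
  rw [absDivSum, coe_mul_zeta_apply]; rfl

/-- `absDivSum κ` is multiplicative when `κ` is. [folklore] -/
theorem isMultiplicative_absDivSum {κ : ArithmeticFunction ℂ} (hκ : κ.IsMultiplicative) :
    (absDivSum κ).IsMultiplicative :=
  (isMultiplicative_normAF hκ).mul isMultiplicative_zeta.natCast

/-- `0 ≤ absDivSum κ m`. [folklore] -/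
theorem absDivSum_nonneg (κ : ArithmeticFunction ℂ) (m : ℕ) : 0 ≤ absDivSum κ m := by
  rw [absDivSum_apply]; exact sum_nonneg fun _ _ => norm_nonneg _

/-- At a prime: `absDivSum κ p = 1 + ‖κ p‖` (`κ` multiplicative). [folklore] -/
theorem absDivSum_prime {κ : ArithmeticFunction ℂ} (hκ : κ.IsMultiplicative) {p : ℕ}
    (hp : p.Prime) : absDivSum κ p = 1 + ‖κ p‖ := by
  rw [absDivSum_apply, hp.divisors, sum_pair hp.one_lt.ne, hκ.map_one, norm_one]

/-- At a prime power: `absDivSum κ (p^ν) = ∑_{i ≤ ν} ‖κ(p^i)‖`. [folklore] -/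
theorem absDivSum_prime_pow (κ : ArithmeticFunction ℂ) {p : ℕ} (hp : p.Prime) (ν : ℕ) :
    absDivSum κ (p ^ ν) = ∑ i ∈ range (ν + 1), ‖κ (p ^ i)‖ := by
  rw [absDivSum_apply, Nat.sum_divisors_prime_pow hp]

/-- If `‖κ(p^i)‖ ≤ (i+1)^c` for all `i` then `absDivSum κ (p^ν) ≤ (ν+1)^{c+1}`. [folklore] -/
theorem absDivSum_prime_pow_le {κ : ArithmeticFunction ℂ} {p : ℕ} (hp : p.Prime) {c : ℕ}
    (hκpow : ∀ i : ℕ, ‖κ (p ^ i)‖ ≤ ((i : ℝ) + 1) ^ c) (ν : ℕ) :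
    absDivSum κ (p ^ ν) ≤ ((ν : ℝ) + 1) ^ (c + 1) := by
  rw [absDivSum_prime_pow κ hp]
  calc ∑ i ∈ range (ν + 1), ‖κ (p ^ i)‖ ≤ ∑ i ∈ range (ν + 1), ((ν : ℝ) + 1) ^ c :=
        sum_le_sum fun i hi => (hκpow i).trans (by
          have h : i + 1 ≤ ν + 1 := by have := mem_range.1 hi; omega
          have h' : (i : ℝ) + 1 ≤ (ν : ℝ) + 1 := by exact_mod_cast h
          exact pow_le_pow_left₀ (by positivity) h' c)
    _ = ((ν : ℝ) + 1) ^ (c + 1) := by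
        rw [sum_const, card_range, nsmul_eq_mul, pow_succ]; push_cast; ring

/-- Pointwise: `|(κ ∗ a)(m)| ≤ C · ∑_{d∣m} |κ(d)|` when `‖a‖_∞ ≤ C`. [folklore] -/
theorem norm_conv_le {κ : ArithmeticFunction ℂ} {a : ℕ → ℂ} {C : ℝ} (ha : ∀ n, ‖a n‖ ≤ C)
    (m : ℕ) : ‖conv κ a m‖ ≤ C * absDivSum κ m := by
  calc ‖conv κ a m‖ ≤ ∑ x ∈ m.divisorsAntidiagonal, ‖κ x.1 * a x.2‖ := norm_sum_le _ _
    _ ≤ ∑ x ∈ m.divisorsAntidiagonal, C * ‖κ x.1‖ := sum_le_sum fun x _ => by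
        rw [norm_mul, mul_comm]
        exact mul_le_mul_of_nonneg_right (ha _) (norm_nonneg _)
    _ = ∑ d ∈ m.divisors, C * ‖κ d‖ :=
        Nat.sum_divisorsAntidiagonal (fun i _ => C * ‖κ i‖)
    _ = C * absDivSum κ m := by rw [absDivSum_apply, mul_sum]

/-- **Mean square of a convolution with a bounded sequence.** Let `κ : ArithmeticFunction ℂ` be
multiplicative with `‖κ(p)‖ ≤ 2 + B log p`, `‖κ(p)‖ ≤ 4` (`B ≥ 0`) and `‖κ(p^i)‖ ≤ (i+1)^c`, and
let `‖a(n)‖ ≤ C` for all `n`. Then for `X ≥ 2`,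
`∑_{m≤X} |(κ∗a)(m)|²/m ≤ C² · majorantConst 9 (2c+2) · exp(16B · log 4X) · (log X)^9`.
[folklore] -/
theorem sum_norm_conv_sq_div_le {κ : ArithmeticFunction ℂ} (hκ : κ.IsMultiplicative)
    {B C : ℝ} (hB : 0 ≤ B) {c : ℕ}
    (hκp : ∀ p, p.Prime → ‖κ p‖ ≤ 2 + B * Real.log p) (hκp4 : ∀ p, p.Prime → ‖κ p‖ ≤ 4)
    (hκpow : ∀ p i : ℕ, p.Prime → ‖κ (p ^ i)‖ ≤ ((i : ℝ) + 1) ^ c)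
    {a : ℕ → ℂ} (ha : ∀ n, ‖a n‖ ≤ C) {X : ℕ} (hX : 2 ≤ X) :
    ∑ m ∈ Icc 1 X, ‖conv κ a m‖ ^ 2 / m ≤
      C ^ 2 * (majorantConst 9 (2 * (c + 1)) * Real.exp (16 * B * Real.log (4 * X)) *
        Real.log X ^ 9) := by
  have hg := isMultiplicative_absDivSum hκ
  have key := sum_sq_div_le (g := fun n => absDivSum κ n) (d := c + 1) hg.map_one
    (fun m n h => hg.map_mul_of_coprime h) (absDivSum_nonneg κ) hB
    (fun p hp => by rw [absDivSum_prime hκ hp]; linarith [hκp p hp])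
    (fun p hp => by rw [absDivSum_prime hκ hp]; linarith [hκp4 p hp])
    (fun p ν hp => absDivSum_prime_pow_le hp (fun i => hκpow p i hp) ν) hX
  calc ∑ m ∈ Icc 1 X, ‖conv κ a m‖ ^ 2 / m
      ≤ ∑ m ∈ Icc 1 X, C ^ 2 * (absDivSum κ m ^ 2 / m) := sum_le_sum fun m _ => by
        rw [← mul_div_assoc, ← mul_pow]
        exact div_le_div_of_nonneg_right
          (pow_le_pow_left₀ (norm_nonneg _) (norm_conv_le ha m) 2) (by positivity)
    _ = C ^ 2 * ∑ m ∈ Icc 1 X, absDivSum κ m ^ 2 / m := by rw [mul_sum]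
    _ ≤ _ := mul_le_mul_of_nonneg_left key (sq_nonneg _)

/-! ### Part 3. Zhang's `κ`: the coefficients of `ζ(s+β₁)ζ(s+β₂)ζ(s+β₃)/ζ(s)`, `β_j = i b_j` -/

/-- The coefficients of `ζ(s + ib)`: `n ↦ n^{-ib}` (`n ≥ 1`), `0 ↦ 0`. [folklore] -/
def powI (b : ℝ) : ArithmeticFunction ℂ :=
  ⟨fun n => if n = 0 then 0 else (n : ℂ) ^ (-(b * Complex.I)), by simp⟩

/-- Unfolding `powI`. [folklore] -/
theorem powI_apply (b : ℝ) (n : ℕ) :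
    powI b n = if n = 0 then 0 else (n : ℂ) ^ (-(b * Complex.I)) := rfl

/-- `powI b n = n^{-ib}` for `n ≠ 0`. [folklore] -/
theorem powI_apply_of_ne_zero (b : ℝ) {n : ℕ} (hn : n ≠ 0) :
    powI b n = (n : ℂ) ^ (-(b * Complex.I)) := by
  rw [powI_apply, if_neg hn]

/-- `n ↦ n^{-ib}` is (completely) multiplicative. [folklore] -/
theorem isMultiplicative_powI (b : ℝ) : (powI b).IsMultiplicative := by
  rw [IsMultiplicative.iff_ne_zero]
  refine ⟨by simp [powI_apply], fun {m n} hm hn _ => ?_⟩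
  rw [powI_apply_of_ne_zero b (mul_ne_zero hm hn), powI_apply_of_ne_zero b hm,
    powI_apply_of_ne_zero b hn, Nat.cast_mul, Complex.natCast_mul_natCast_cpow]

/-- `|n^{-ib}| = 1` for `n ≥ 1`. [folklore] -/
theorem norm_powI_of_pos (b : ℝ) {n : ℕ} (hn : 0 < n) : ‖powI b n‖ = 1 := by
  rw [powI_apply_of_ne_zero b hn.ne', Complex.norm_natCast_cpow_of_pos hn]
  simp

/-- `|n^{-ib} − 1| ≤ |b| log n` for `n ≥ 1` (`n^{-ib} = e^{-ib log n}` and `|e^{it} − 1| ≤ |t|`).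
[folklore] -/
theorem norm_powI_sub_one_le (b : ℝ) {n : ℕ} (hn : 0 < n) :
    ‖powI b n - 1‖ ≤ |b| * Real.log n := by
  have hn' : (n : ℂ) ≠ 0 := by exact_mod_cast hn.ne'
  rw [powI_apply_of_ne_zero b hn.ne', Complex.cpow_def_of_ne_zero hn', ← Complex.natCast_log]
  have e : (Real.log n : ℂ) * -(b * Complex.I) = Complex.I * ((-(b * Real.log n) : ℝ) : ℂ) := by
    push_cast; ring
  rw [e]
  calc ‖Complex.exp (Complex.I * ((-(b * Real.log n) : ℝ) : ℂ)) - 1‖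
      ≤ ‖(-(b * Real.log n) : ℝ)‖ := Real.norm_exp_I_mul_ofReal_sub_one_le
    _ = |b| * Real.log n := by
        rw [Real.norm_eq_abs, abs_neg, abs_mul,
          abs_of_nonneg (Real.log_nonneg (Nat.one_le_cast.mpr hn))]

/-- **Zhang's `κ`** [p. 13]: the arithmetic function with
`∑_n κ(n) n^{-s} = ζ(s+β₁)ζ(s+β₂)ζ(s+β₃)/ζ(s)` for purely imaginary shifts `β_j = i b_j`
((2.13)), DEFINED as the Dirichlet convolution `n^{-β₁} ∗ n^{-β₂} ∗ n^{-β₃} ∗ μ` of the four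
coefficient sequences. [cite: Zhang2022LandauSiegel, §7 p. 13 (definition of κ) and (2.13) p. 5] -/
def kappa (b₁ b₂ b₃ : ℝ) : ArithmeticFunction ℂ :=
  powI b₁ * powI b₂ * powI b₃ * (ArithmeticFunction.moebius : ArithmeticFunction ℂ)

/-- `κ` is multiplicative. [folklore] -/
theorem isMultiplicative_kappa (b₁ b₂ b₃ : ℝ) : (kappa b₁ b₂ b₃).IsMultiplicative :=
  (((isMultiplicative_powI b₁).mul (isMultiplicative_powI b₂)).mul
    (isMultiplicative_powI b₃)).mul isMultiplicative_moebius_complex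

/-- Dirichlet convolution at a prime: `(f ∗ g)(p) = f(p) + g(p)` when `f(1) = g(1) = 1`.
[folklore] -/
theorem mul_apply_prime {R : Type*} [CommSemiring R] {f g : ArithmeticFunction R}
    (hf : f 1 = 1) (hg : g 1 = 1) {p : ℕ} (hp : p.Prime) : (f * g) p = f p + g p := by
  rw [mul_apply, Nat.sum_divisorsAntidiagonal (fun i j => f i * g j), hp.divisors,
    sum_pair hp.one_lt.ne, Nat.div_one, Nat.div_self hp.pos, hf, hg, one_mul, mul_one, add_comm]

/-- If `‖f(p^i)‖ ≤ (i+1)^c` and `‖g(p^j)‖ ≤ 1` at all powers of `p` then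
`‖(f ∗ g)(p^k)‖ ≤ (k+1)^{c+1}`. [folklore] -/
theorem norm_mul_apply_prime_pow_le {f g : ArithmeticFunction ℂ} {p : ℕ} (hp : p.Prime)
    {c : ℕ} (hf : ∀ i : ℕ, ‖f (p ^ i)‖ ≤ ((i : ℝ) + 1) ^ c) (hg : ∀ j : ℕ, ‖g (p ^ j)‖ ≤ 1) (k : ℕ) :
    ‖(f * g) (p ^ k)‖ ≤ ((k : ℝ) + 1) ^ (c + 1) := by
  rw [RankinEisenstein.mul_apply_prime_pow f g hp k]
  calc ‖∑ i ∈ range (k + 1), f (p ^ i) * g (p ^ (k - i))‖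
      ≤ ∑ i ∈ range (k + 1), ‖f (p ^ i) * g (p ^ (k - i))‖ := norm_sum_le _ _
    _ ≤ ∑ i ∈ range (k + 1), ((k : ℝ) + 1) ^ c := sum_le_sum fun i hi => by
        rw [norm_mul]
        have h : i + 1 ≤ k + 1 := by have := mem_range.1 hi; omega
        have h' : (i : ℝ) + 1 ≤ (k : ℝ) + 1 := by exact_mod_cast h
        calc ‖f (p ^ i)‖ * ‖g (p ^ (k - i))‖ ≤ ((i : ℝ) + 1) ^ c * 1 :=
            mul_le_mul (hf i) (hg _) (norm_nonneg _) (by positivity)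
          _ ≤ ((k : ℝ) + 1) ^ c := by
            rw [mul_one]; exact pow_le_pow_left₀ (by positivity) h' c
    _ = ((k : ℝ) + 1) ^ (c + 1) := by
        rw [sum_const, card_range, nsmul_eq_mul, pow_succ]; push_cast; ring

/-- `κ(p) = p^{-β₁} + p^{-β₂} + p^{-β₃} − 1` at a prime `p`.
[cite: Zhang2022LandauSiegel, §7 p. 13] -/
theorem kappa_apply_prime (b₁ b₂ b₃ : ℝ) {p : ℕ} (hp : p.Prime) :
    kappa b₁ b₂ b₃ p = powI b₁ p + powI b₂ p + powI b₃ p - 1 := by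
  have h1 := isMultiplicative_powI b₁
  have h12 := h1.mul (isMultiplicative_powI b₂)
  have h123 := h12.mul (isMultiplicative_powI b₃)
  rw [kappa, mul_apply_prime h123.map_one isMultiplicative_moebius_complex.map_one hp,
    mul_apply_prime h12.map_one (isMultiplicative_powI b₃).map_one hp,
    mul_apply_prime h1.map_one (isMultiplicative_powI b₂).map_one hp,
    moebius_complex_apply_prime hp]
  ring

/-- `|κ(p)| ≤ 2 + (|b₁| + |b₂| + |b₃|) log p`: three unimodular shifts minus Möbius' `−1`, each
shift within `|b_j| log p` of `1`. [folklore] -/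
theorem norm_kappa_prime_le (b₁ b₂ b₃ : ℝ) {p : ℕ} (hp : p.Prime) :
    ‖kappa b₁ b₂ b₃ p‖ ≤ 2 + (|b₁| + |b₂| + |b₃|) * Real.log p := by
  rw [kappa_apply_prime b₁ b₂ b₃ hp]
  have h1 := norm_powI_sub_one_le b₁ hp.pos
  have h2 := norm_powI_sub_one_le b₂ hp.pos
  have h3 := norm_powI_sub_one_le b₃ hp.pos
  have e : powI b₁ p + powI b₂ p + powI b₃ p - 1 =
      (powI b₁ p - 1) + (powI b₂ p - 1) + (powI b₃ p - 1) + 2 := by ring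
  rw [e]
  calc ‖(powI b₁ p - 1) + (powI b₂ p - 1) + (powI b₃ p - 1) + 2‖
      ≤ ‖(powI b₁ p - 1) + (powI b₂ p - 1) + (powI b₃ p - 1)‖ + ‖(2 : ℂ)‖ := norm_add_le _ _
    _ ≤ ‖powI b₁ p - 1‖ + ‖powI b₂ p - 1‖ + ‖powI b₃ p - 1‖ + 2 := by
        rw [Complex.norm_two]
        gcongr
        exact norm_add₃_le
    _ ≤ |b₁| * Real.log p + |b₂| * Real.log p + |b₃| * Real.log p + 2 := by linarith
    _ = 2 + (|b₁| + |b₂| + |b₃|) * Real.log p := by ring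

/-- `|κ(p)| ≤ 4`. [folklore] -/
theorem norm_kappa_prime_le_four (b₁ b₂ b₃ : ℝ) {p : ℕ} (hp : p.Prime) :
    ‖kappa b₁ b₂ b₃ p‖ ≤ 4 := by
  rw [kappa_apply_prime b₁ b₂ b₃ hp]
  have h1 := norm_powI_of_pos b₁ hp.pos
  have h2 := norm_powI_of_pos b₂ hp.pos
  have h3 := norm_powI_of_pos b₃ hp.pos
  calc ‖powI b₁ p + powI b₂ p + powI b₃ p - 1‖
      ≤ ‖powI b₁ p + powI b₂ p + powI b₃ p‖ + ‖(1 : ℂ)‖ := norm_sub_le _ _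
    _ ≤ ‖powI b₁ p‖ + ‖powI b₂ p‖ + ‖powI b₃ p‖ + 1 := by
        rw [norm_one]
        gcongr
        exact norm_add₃_le
    _ = 4 := by rw [h1, h2, h3]; norm_num

/-- `|κ(p^k)| ≤ (k+1)³` (indeed `≤ ∑_{i≤k} binom(i+2,2) ≤ τ₄(p^k)`). [folklore] -/
theorem norm_kappa_prime_pow_le (b₁ b₂ b₃ : ℝ) {p : ℕ} (hp : p.Prime) (k : ℕ) :
    ‖kappa b₁ b₂ b₃ (p ^ k)‖ ≤ ((k : ℝ) + 1) ^ 3 := by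
  have hI : ∀ (b : ℝ) (i : ℕ), ‖powI b (p ^ i)‖ ≤ 1 := fun b i =>
    (norm_powI_of_pos b (pow_pos hp.pos i)).le
  have h0 : ∀ i : ℕ, ‖powI b₁ (p ^ i)‖ ≤ ((i : ℝ) + 1) ^ 0 := fun i => by
    rw [pow_zero]; exact hI b₁ i
  have h1 : ∀ i : ℕ, ‖(powI b₁ * powI b₂) (p ^ i)‖ ≤ ((i : ℝ) + 1) ^ 1 :=
    norm_mul_apply_prime_pow_le hp h0 (hI b₂)
  have h2 : ∀ i : ℕ, ‖(powI b₁ * powI b₂ * powI b₃) (p ^ i)‖ ≤ ((i : ℝ) + 1) ^ 2 :=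
    norm_mul_apply_prime_pow_le hp h1 (hI b₃)
  exact norm_mul_apply_prime_pow_le hp h2 (fun j => norm_moebius_complex_le_one _) k

/-- **(7.5), the mean-square input with exponent `9`.** For Zhang's `κ` (purely imaginary shifts
`β_j = i b_j`) and ANY sequence `a` with `‖a(n)‖ ≤ C`, for `X ≥ 2`:
`∑_{m≤X} |(κ∗a)(m)|²/m ≤ C² · majorantConst 9 8 · exp(16(|b₁|+|b₂|+|b₃|) log 4X) · (log X)^9`.
(The source uses the range `m < P²`; `m ≤ X = P²` is a superset.) The manuscript's own count at
this point is `≪ ∑_{m<P²} τ₅(m)²/m ≍ (log P²)^{25}` [p. 13]; nothing about the manuscript's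
theorems is asserted. [cite: Zhang2022LandauSiegel, §7 (7.5) p. 13] -/
theorem sum_norm_kappa_conv_sq_div_le (b₁ b₂ b₃ : ℝ) {a : ℕ → ℂ} {C : ℝ}
    (ha : ∀ n, ‖a n‖ ≤ C) {X : ℕ} (hX : 2 ≤ X) :
    ∑ m ∈ Icc 1 X, ‖conv (kappa b₁ b₂ b₃) a m‖ ^ 2 / m ≤
      C ^ 2 * (majorantConst 9 8 *
        Real.exp (16 * (|b₁| + |b₂| + |b₃|) * Real.log (4 * X)) * Real.log X ^ 9) :=
  sum_norm_conv_sq_div_le (isMultiplicative_kappa b₁ b₂ b₃) (by positivity) (c := 3)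
    (fun p hp => norm_kappa_prime_le b₁ b₂ b₃ hp)
    (fun p hp => norm_kappa_prime_le_four b₁ b₂ b₃ hp)
    (fun p i hp => norm_kappa_prime_pow_le b₁ b₂ b₃ hp i) ha hX

/-- **(7.5) in the source's normalisation.** If moreover `(|b₁|+|b₂|+|b₃|) · log X ≤ L` and
`X ≥ 4` (in the source: `X = P²`, `∑|b_j| ≤ 6α(1 + 5c′α𝓛)` by (2.13), `α log P² = 2π` by
(2.10), so `L = 12π(1 + 5c′α𝓛)`), then
`∑_{m≤X} |(κ∗a)(m)|²/m ≤ C² · majorantConst 9 8 · e^{32L} · (log X)^9` — a bound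
`‖a‖_∞² · O(1) · (log P²)^9`. [cite: Zhang2022LandauSiegel, §7 (7.5) p. 13, (2.10) p. 4, (2.13) p. 5] -/
theorem sum_norm_kappa_conv_sq_div_le_of_mul_log_le (b₁ b₂ b₃ : ℝ) {a : ℕ → ℂ} {C L : ℝ}
    (ha : ∀ n, ‖a n‖ ≤ C) {X : ℕ} (hX : 4 ≤ X)
    (hL : (|b₁| + |b₂| + |b₃|) * Real.log X ≤ L) :
    ∑ m ∈ Icc 1 X, ‖conv (kappa b₁ b₂ b₃) a m‖ ^ 2 / m ≤
      C ^ 2 * majorantConst 9 8 * Real.exp (32 * L) * Real.log X ^ 9 := by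
  have h := sum_norm_kappa_conv_sq_div_le b₁ b₂ b₃ ha (le_trans (by norm_num) hX)
  have hX' : (4 : ℝ) ≤ X := by exact_mod_cast hX
  have hX0 : (0 : ℝ) < X := by linarith
  have hM : 0 ≤ majorantConst 9 8 := (majorantConst_pos 9 8).le
  have hlog : Real.log (4 * X) ≤ 2 * Real.log X := by
    calc Real.log (4 * X) ≤ Real.log (X * X) := Real.log_le_log (by positivity) (by nlinarith)
      _ = 2 * Real.log X := by rw [Real.log_mul hX0.ne' hX0.ne']; ring
  have hexp : Real.exp (16 * (|b₁| + |b₂| + |b₃|) * Real.log (4 * X)) ≤ Real.exp (32 * L) := by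
    apply Real.exp_le_exp.2
    have hB : 0 ≤ |b₁| + |b₂| + |b₃| := by positivity
    calc 16 * (|b₁| + |b₂| + |b₃|) * Real.log (4 * X)
        ≤ 16 * (|b₁| + |b₂| + |b₃|) * (2 * Real.log X) :=
          mul_le_mul_of_nonneg_left hlog (by positivity)
      _ = 32 * ((|b₁| + |b₂| + |b₃|) * Real.log X) := by ring
      _ ≤ 32 * L := by linarith
  have hL9 : 0 ≤ Real.log X ^ 9 := pow_nonneg (Real.log_nonneg (by linarith)) 9
  calc ∑ m ∈ Icc 1 X, ‖conv (kappa b₁ b₂ b₃) a m‖ ^ 2 / m ≤ _ := h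
    _ ≤ C ^ 2 * (majorantConst 9 8 * Real.exp (32 * L) * Real.log X ^ 9) := by
        apply mul_le_mul_of_nonneg_left _ (sq_nonneg _)
        exact mul_le_mul_of_nonneg_right (mul_le_mul_of_nonneg_left hexp hM) hL9
    _ = C ^ 2 * majorantConst 9 8 * Real.exp (32 * L) * Real.log X ^ 9 := by ring

end Literature.NumberTheory.LFunctions.Zhang2022.MeanSquareMajorant
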